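import Summits.QuantumFields.YangMills.Theorems.ConvexGribovBodyBrascampLiebVacuumSCStubHaarSandwich
import Summits.QuantumFields.YangMills.Theorems.ConvexGribovBodyBrascampLiebVacuumSCStubExpLocal
import Summits.QuantumFields.YangMills.Theorems.ConvexGribovBodyCovarianceBoundPerpVanish

/-!
# Crux `BrascampLiebVacuumSC` (stmt-QuantumFields-16404), line `SketchIdeator1`, skeleton v7:
# helpers for the metric-entropy assembly `stub_gapAssembly`

Skeleton v7 (`Cruxes/BrascampLiebVacuumSC/Lines/SketchIdeator1.lean`, lead c4) derives the Haar
dimension gap of a compact simple `G` with a faithful unitary `ρ` (ball growth `μ(B_ε) ≥ c ε^d`, thin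
involutions `μ(J_ε) ≤ C ε^m`, `d < 3m`) from an `exp`-chart `V` of `ρ(G)` at `1`, a dimension bound for
the `−1`-eigenspaces of non-central involutions, Euclidean nets, a Haar covering/packing sandwich and the
local bi-Lipschitz property of `exp`. This file holds the sorry-free geometric helpers of that assembly,
all stated over the tree's vocabulary (`froSq`, `LatticeRep`, `haarProbability`) with the relevant stub
hypotheses passed explicitly:

* Frobenius bookkeeping (`froSq_smul`, `froSq_rho_mul_sub`; the translated balls and their Haar measure
  come from `HaarSandwich`, `froSq M = 0 ⇒ M = 0` from `ExpLocal`) and the preimage selector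
  `Function.invFun ρ` (`rho_invFun`);
* finite `η`-nets of compact subsets of `G` (`exists_finset_net`), compactness of the involutions;
* `finrank_pos`: the chart dimension is positive for a connected non-abelian `G`;
* `eq_zero_of_mem_center`: a central involution has trivial `−1`-eigenspace in `V`;
* `exists_net` / `exists_packing`: nets and packings of `G` from nets and packings of `V ∩ B_s`
  (`exists_net` is also recorded in closed form as the registered sub-goal `stub_gapAssemblyNet`).

No named facts are used.
-/

set_option autoImplicit false

open scoped BigOperators Topology Matrix ENNReal
open Filter MeasureTheory
open Literature.MathematicalPhysics.QuantumFieldTheory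
open Summit.QuantumFields.YangMills.Cruxes.CovarianceBound.SupportWindow (froSq)
open Summit.QuantumFields.YangMills.Cruxes.CovarianceBound.SupportWindow.SupMeasurable
  (froSq_nonneg continuous_froSq)
open Summit.QuantumFields.YangMills.Cruxes.CovarianceBound.SupportWindow.PerpVanish (froSq_zero)

noncomputable section

namespace Summit.QuantumFields.YangMills.Theorems.BrascampLiebVacuumSC

namespace GapAssembly

/-! ### Frobenius bookkeeping -/

/-- `froSq (t • X) = t² · froSq X` for a real scalar `t`. [folklore] -/
theorem froSq_smul {N : ℕ} (t : ℝ) (X : Matrix (Fin N) (Fin N) ℂ) :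
    froSq (t • X) = t ^ 2 * froSq X := by
  unfold froSq
  simp only [Matrix.smul_apply, Complex.real_smul, norm_mul, Complex.norm_real, Real.norm_eq_abs,
    mul_pow, sq_abs, Finset.mul_sum]

variable {G : Type} [Group G] [TopologicalSpace G]

/-- `‖ρ x · A − ρ x · B‖²_F = ‖A − B‖²_F`. [folklore] -/
theorem froSq_rho_mul_sub (r : LatticeRep G) (x : G) (A B : Matrix (Fin r.N) (Fin r.N) ℂ) :
    froSq (r.ρ x * A - r.ρ x * B) = froSq (A - B) := by
  rw [← mul_sub, GaugeAlgebra.froSq_unitary_mul (r.mem_unitary _)]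

/-- The preimage selector `Function.invFun ρ` inverts `ρ` on its range. [folklore] -/
theorem rho_invFun (r : LatticeRep G) {M : Matrix (Fin r.N) (Fin r.N) ℂ} (h : M ∈ Set.range r.ρ) :
    r.ρ (Function.invFun r.ρ M) = M :=
  Function.invFun_eq h

/-! ### Compactness: finite nets -/

/-- **Finite `η`-nets.** A compact `K ⊆ G` contains a finite `S` such that every `g ∈ K` has
`‖ρ g − ρ x‖²_F < η²` for some `x ∈ S` (the Frobenius balls are open as `ρ` is continuous).
[folklore] -/
theorem exists_finset_net (r : LatticeRep G) {K : Set G} (hK : IsCompact K) {η : ℝ} (hη : 0 < η) :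
    ∃ S : Finset G, (∀ x ∈ S, x ∈ K) ∧ ∀ g ∈ K, ∃ x ∈ S, froSq (r.ρ g - r.ρ x) < η ^ 2 := by
  have hU : ∀ x ∈ K, {g : G | froSq (r.ρ g - r.ρ x) < η ^ 2} ∈ 𝓝 x := by
    intro x _
    refine (HaarSandwich.isOpen_froBall r x _).mem_nhds ?_
    show froSq (r.ρ x - r.ρ x) < η ^ 2
    rw [sub_self, froSq_zero]
    positivity
  obtain ⟨S, hSK, hcov⟩ :=
    hK.elim_nhds_subcover (fun x => {g : G | froSq (r.ρ g - r.ρ x) < η ^ 2}) hU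
  refine ⟨S, hSK, fun g hg => ?_⟩
  have := hcov hg
  simp only [Set.mem_iUnion, Set.mem_setOf_eq, exists_prop] at this
  exact this

/-- The involutions `{j : j² = 1}` of a compact group with a faithful continuous matrix
representation form a compact set (`G` is Hausdorff through `ρ`). [folklore] -/
theorem isCompact_invol [IsTopologicalGroup G] [CompactSpace G] (r : LatticeRep G) :
    IsCompact {j : G | j * j = 1} := by
  haveI : T2Space G := T2Space.of_injective_continuous r.injective r.continuous
  have hc : Continuous fun j : G => j * j := continuous_id.mul continuous_id
  exact (isClosed_eq hc continuous_const).isCompact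

/-! ### `d = dim V > 0` -/

/-- **The chart dimension is positive.** If `V` charts a neighbourhood of `1` through `exp` and
`dim V = 0`, then the ball `B_η = {1}` is clopen in the connected `G`, so `G` is trivial — but a compact
simple group is non-abelian. [folklore] -/
theorem finrank_pos [CompactSpace G] (hG : IsCompactSimpleLieGroup G) (r : LatticeRep G)
    (V : Submodule ℝ (Matrix (Fin r.N) (Fin r.N) ℂ))
    (hchart : ∀ s : ℝ, 0 < s → ∃ η : ℝ, 0 < η ∧ ∀ g : G, froSq (r.ρ g - 1) < η ^ 2 →
      ∃ X ∈ V, froSq X < s ^ 2 ∧ NormedSpace.exp X = r.ρ g) :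
    0 < Module.finrank ℝ V := by
  by_contra hd
  have hV : V = ⊥ := Submodule.finrank_eq_zero.1 (Nat.eq_zero_of_not_pos hd)
  obtain ⟨η, hη, hch⟩ := hchart 1 one_pos
  haveI : T2Space G := T2Space.of_injective_continuous r.injective r.continuous
  obtain ⟨hconn, ⟨a, b, hab⟩, -⟩ := hG.1
  have hball : {g : G | froSq (r.ρ g - 1) < η ^ 2} = {1} := by
    ext g
    simp only [Set.mem_setOf_eq, Set.mem_singleton_iff]
    constructor
    · intro hg
      obtain ⟨X, hXV, -, hexpX⟩ := hch g hg
      rw [hV, Submodule.mem_bot] at hXV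
      rw [hXV, NormedSpace.exp_zero] at hexpX
      exact r.injective (by rw [map_one]; exact hexpX.symm)
    · rintro rfl
      rw [map_one, sub_self, froSq_zero]
      positivity
  have hopen : IsOpen {g : G | froSq (r.ρ g - 1) < η ^ 2} :=
    isOpen_lt (continuous_froSq.comp (r.continuous.sub continuous_const)) continuous_const
  rw [hball] at hopen
  have hclopen : IsClopen ({1} : Set G) := ⟨isClosed_singleton, hopen⟩
  have huniv : ({1} : Set G) = Set.univ := hclopen.eq_univ (Set.singleton_nonempty 1)
  have h1 : ∀ g : G, g = 1 := fun g => by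
    have hg : g ∈ (Set.univ : Set G) := Set.mem_univ g
    rw [← huniv] at hg
    exact hg
  exact hab (by rw [h1 a, h1 b])

/-! ### Central involutions have trivial `−1`-eigenspace in `V` -/

/-- **Central involutions act trivially on the chart.** If `j ∈ Z(G)`, `j² = 1`, `X ∈ V` (so every
`exp (tX)` is some `ρ g`, which commutes with `P = ρ j`) and `P X P = −X`, then
`exp (tX) = P exp(tX) P = exp (t PXP) = exp (−tX)` for all `t`; for small `t` the local injectivity of
`exp` gives `tX = −tX`, so `X = 0`. [folklore] -/
theorem eq_zero_of_mem_center (r : LatticeRep G) (V : Submodule ℝ (Matrix (Fin r.N) (Fin r.N) ℂ))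
    (hV : ∀ X ∈ V, ∀ t : ℝ, NormedSpace.exp (t • X) ∈ Set.range r.ρ)
    {r₀ : ℝ} (hr₀ : 0 < r₀)
    (hlip : ∀ X Y : Matrix (Fin r.N) (Fin r.N) ℂ, froSq X < r₀ ^ 2 → froSq Y < r₀ ^ 2 →
      froSq (X - Y) ≤ 4 * froSq (NormedSpace.exp X - NormedSpace.exp Y))
    {j : G} (hj : j * j = 1) (hjc : j ∈ Subgroup.center G)
    {X : Matrix (Fin r.N) (Fin r.N) ℂ} (hXV : X ∈ V) (hXK : r.ρ j * X * r.ρ j = -X) : X = 0 := by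
  have hPP : r.ρ j * r.ρ j = 1 := by rw [← map_mul, hj, map_one]
  -- `exp (tX) = exp (−tX)` for all `t`
  have hsym : ∀ t : ℝ, NormedSpace.exp (t • X) = NormedSpace.exp (-(t • X)) := by
    intro t
    obtain ⟨g, hg⟩ := hV X hXV t
    have hjg : j * g * j = g := by
      rw [← Subgroup.mem_center_iff.1 hjc g, mul_assoc, hj, mul_one]
    have h1 : r.ρ j * NormedSpace.exp (t • X) * r.ρ j = NormedSpace.exp (t • X) := by
      rw [← hg, ← map_mul, ← map_mul, hjg]
    have h2 : r.ρ j * NormedSpace.exp (t • X) * r.ρ j =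
        NormedSpace.exp (r.ρ j * (t • X) * r.ρ j) := by
      have := Matrix.exp_units_conj
        (⟨r.ρ j, r.ρ j, hPP, hPP⟩ : (Matrix (Fin r.N) (Fin r.N) ℂ)ˣ) (t • X)
      simpa using this.symm
    rw [← h1, h2, Matrix.mul_smul, Matrix.smul_mul, hXK, smul_neg]
  -- a small nonzero `t`
  set t : ℝ := r₀ / (froSq X + 1) with ht
  have hf0 : 0 ≤ froSq X := froSq_nonneg X
  have htpos : 0 < t := by positivity
  have htX : froSq (t • X) < r₀ ^ 2 := by
    rw [froSq_smul, ht, div_pow, div_mul_eq_mul_div, div_lt_iff₀ (by positivity)]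
    nlinarith [sq_nonneg r₀,
      mul_pos (pow_pos hr₀ 2) (show (0 : ℝ) < froSq X ^ 2 + froSq X + 1 by positivity)]
  have htX' : froSq (-(t • X)) < r₀ ^ 2 := by rwa [DimensionGap.froSq_neg]
  have hle := hlip (t • X) (-(t • X)) htX htX'
  rw [← hsym t, sub_self, froSq_zero, mul_zero, sub_neg_eq_add] at hle
  have h0 : froSq (t • X + t • X) = 0 := le_antisymm hle (froSq_nonneg _)
  have h0' := ExpLocal.eq_zero_of_froSq_eq_zero h0
  rw [← add_smul, smul_eq_zero] at h0'
  rcases h0' with h | h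
  · exfalso; linarith
  · exact h

/-! ### Nets and packings of `G` from nets and packings of `V ∩ B_s` -/

/-- **Covering.** An `η`-net `SG` of `G`, the chart at scale `s` and an `ε/2`-net `T` of `V ∩ B_s` give
the `ε`-net `{x · ρ⁻¹(exp Y) : x ∈ SG, Y ∈ T}` of `G` (`exp` is `2`-Lipschitz on `B_s`), of size
`≤ |SG| · |T|`. [folklore] -/
theorem exists_net (r : LatticeRep G) (V : Submodule ℝ (Matrix (Fin r.N) (Fin r.N) ℂ))
    (hV1 : ∀ X ∈ V, NormedSpace.exp X ∈ Set.range r.ρ) {s η r₀ ε : ℝ} (hsr : s ^ 2 ≤ r₀ ^ 2)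
    (hch : ∀ g : G, froSq (r.ρ g - 1) < η ^ 2 →
      ∃ X ∈ V, froSq X < s ^ 2 ∧ NormedSpace.exp X = r.ρ g)
    (hlip : ∀ X Y : Matrix (Fin r.N) (Fin r.N) ℂ, froSq X < r₀ ^ 2 → froSq Y < r₀ ^ 2 →
      froSq (NormedSpace.exp X - NormedSpace.exp Y) ≤ 4 * froSq (X - Y))
    (SG : Finset G) (hSG : ∀ g : G, ∃ x ∈ SG, froSq (r.ρ g - r.ρ x) < η ^ 2)
    (T : Finset (Matrix (Fin r.N) (Fin r.N) ℂ))
    (hT1 : ↑T ⊆ (V : Set (Matrix (Fin r.N) (Fin r.N) ℂ)) ∩ {X | froSq X < s ^ 2})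
    (hT2 : ∀ X ∈ V, froSq X < s ^ 2 → ∃ Y ∈ T, froSq (X - Y) < (ε / 2) ^ 2) :
    ∃ Tc : Finset G, Tc.card ≤ SG.card * T.card ∧
      ∀ g : G, ∃ x ∈ Tc, froSq (r.ρ g - r.ρ x) < ε ^ 2 := by
  classical
  refine ⟨SG.biUnion fun x => T.image fun Y => x * Function.invFun r.ρ (NormedSpace.exp Y), ?_, ?_⟩
  · calc (SG.biUnion fun x => T.image fun Y => x * Function.invFun r.ρ (NormedSpace.exp Y)).card
          ≤ ∑ x ∈ SG, (T.image fun Y => x * Function.invFun r.ρ (NormedSpace.exp Y)).card :=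
            Finset.card_biUnion_le
      _ ≤ ∑ _x ∈ SG, T.card := Finset.sum_le_sum fun x _ => Finset.card_image_le
      _ = SG.card * T.card := by rw [Finset.sum_const, smul_eq_mul]
  · intro g
    obtain ⟨x, hx, hgx⟩ := hSG g
    rw [← HaarSandwich.froSq_inv_mul_sub_one] at hgx
    obtain ⟨X, hXV, hXs, hXe⟩ := hch (x⁻¹ * g) hgx
    obtain ⟨Y, hY, hXY⟩ := hT2 X hXV hXs
    have hY' := hT1 (Finset.mem_coe.2 hY)
    refine ⟨x * Function.invFun r.ρ (NormedSpace.exp Y),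
      Finset.mem_biUnion.2 ⟨x, hx, Finset.mem_image.2 ⟨Y, hY, rfl⟩⟩, ?_⟩
    have hρ : r.ρ (x * Function.invFun r.ρ (NormedSpace.exp Y)) = r.ρ x * NormedSpace.exp Y := by
      rw [map_mul, rho_invFun r (hV1 Y hY'.1)]
    have hg' : r.ρ g = r.ρ x * NormedSpace.exp X := by
      rw [hXe, ← map_mul, mul_inv_cancel_left]
    rw [hρ, hg', froSq_rho_mul_sub]
    calc froSq (NormedSpace.exp X - NormedSpace.exp Y) ≤ 4 * froSq (X - Y) :=
          hlip X Y (hXs.trans_le hsr) (hY'.2.trans_le hsr)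
      _ < 4 * (ε / 2) ^ 2 := by gcongr
      _ = ε ^ 2 := by ring

/-- **Packing.** A `4ε`-separated `T ⊆ V ∩ B_s` gives the `2ε`-separated (in `‖ρ · − ρ ·‖_F`) set
`ρ⁻¹(exp T)` of the same size (`exp` is co-Lipschitz with constant `2` on `B_s`). [folklore] -/
theorem exists_packing (r : LatticeRep G) (V : Submodule ℝ (Matrix (Fin r.N) (Fin r.N) ℂ))
    (hV1 : ∀ X ∈ V, NormedSpace.exp X ∈ Set.range r.ρ) {s r₀ ε : ℝ} (hsr : s ^ 2 ≤ r₀ ^ 2)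
    (hε : 0 < ε)
    (hlip' : ∀ X Y : Matrix (Fin r.N) (Fin r.N) ℂ, froSq X < r₀ ^ 2 → froSq Y < r₀ ^ 2 →
      froSq (X - Y) ≤ 4 * froSq (NormedSpace.exp X - NormedSpace.exp Y))
    (T : Finset (Matrix (Fin r.N) (Fin r.N) ℂ))
    (hT1 : ↑T ⊆ (V : Set (Matrix (Fin r.N) (Fin r.N) ℂ)) ∩ {X | froSq X < s ^ 2})
    (hT3 : ∀ X ∈ T, ∀ Y ∈ T, X ≠ Y → (4 * ε) ^ 2 ≤ froSq (X - Y)) :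
    ∃ TG : Finset G, TG.card = T.card ∧
      ∀ x ∈ TG, ∀ y ∈ TG, x ≠ y → (2 * ε) ^ 2 ≤ froSq (r.ρ x - r.ρ y) := by
  classical
  set f : Matrix (Fin r.N) (Fin r.N) ℂ → G := fun Y => Function.invFun r.ρ (NormedSpace.exp Y)
    with hf
  have hρf : ∀ Y ∈ T, r.ρ (f Y) = NormedSpace.exp Y := fun Y hY =>
    rho_invFun r (hV1 Y (hT1 (Finset.mem_coe.2 hY)).1)
  have hkey : ∀ X ∈ T, ∀ Y ∈ T, X ≠ Y → (2 * ε) ^ 2 ≤ froSq (r.ρ (f X) - r.ρ (f Y)) := by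
    intro X hX Y hY hXY
    rw [hρf X hX, hρf Y hY]
    have h1 := hT3 X hX Y hY hXY
    have h2 := hlip' X Y ((hT1 (Finset.mem_coe.2 hX)).2.trans_le hsr)
      ((hT1 (Finset.mem_coe.2 hY)).2.trans_le hsr)
    nlinarith [h1, h2]
  have hinj : Set.InjOn f ↑T := by
    intro X hX Y hY hXY
    by_contra hne
    have h := hkey X (Finset.mem_coe.1 hX) Y (Finset.mem_coe.1 hY) hne
    rw [hXY, sub_self, froSq_zero] at h
    nlinarith [h, hε]
  refine ⟨T.image f, Finset.card_image_of_injOn hinj, ?_⟩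
  intro x hx y hy hxy
  obtain ⟨X, hX, rfl⟩ := Finset.mem_image.1 hx
  obtain ⟨Y, hY, rfl⟩ := Finset.mem_image.1 hy
  exact hkey X hX Y hY fun h => hxy (by rw [h])

end GapAssembly

/-- **Registered sub-goal `stub_gapAssemblyNet` of `stub_gapAssembly`** (the covering half of the ball
growth, `GapAssembly.exists_net` in closed form): an `η`-net `SG` of `G`, the `exp`-chart of `V` at scale
`s`, the `2`-Lipschitz bound for `exp` on `B_{r₀} ⊇ B_s` and an `ε/2`-net `T` of `V ∩ B_s` give an `ε`-net of
`G` in the Frobenius distance of size `≤ |SG| · |T|`. [folklore] -/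
theorem stub_gapAssemblyNet :
    ∀ (G : Type) [Group G] [TopologicalSpace G] (r : LatticeRep G)
    (V : Submodule ℝ (Matrix (Fin r.N) (Fin r.N) ℂ)) (s η r₀ ε : ℝ) (SG : Finset G)
    (T : Finset (Matrix (Fin r.N) (Fin r.N) ℂ)),
    (∀ X ∈ V, NormedSpace.exp X ∈ Set.range r.ρ) → s ^ 2 ≤ r₀ ^ 2 →
    (∀ g : G, froSq (r.ρ g - 1) < η ^ 2 → ∃ X ∈ V, froSq X < s ^ 2 ∧ NormedSpace.exp X = r.ρ g) →
    (∀ X Y : Matrix (Fin r.N) (Fin r.N) ℂ, froSq X < r₀ ^ 2 → froSq Y < r₀ ^ 2 →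
      froSq (NormedSpace.exp X - NormedSpace.exp Y) ≤ 4 * froSq (X - Y)) →
    (∀ g : G, ∃ x ∈ SG, froSq (r.ρ g - r.ρ x) < η ^ 2) →
    ↑T ⊆ (V : Set (Matrix (Fin r.N) (Fin r.N) ℂ)) ∩ {X | froSq X < s ^ 2} →
    (∀ X ∈ V, froSq X < s ^ 2 → ∃ Y ∈ T, froSq (X - Y) < (ε / 2) ^ 2) →
    ∃ Tc : Finset G, Tc.card ≤ SG.card * T.card ∧
      ∀ g : G, ∃ x ∈ Tc, froSq (r.ρ g - r.ρ x) < ε ^ 2 :=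
  fun _G _ _ r V _s _η _r₀ _ε SG T hV1 hsr hch hlip hSG hT1 hT2 =>
    GapAssembly.exists_net r V hV1 hsr hch hlip SG hSG T hT1 hT2

end Summit.QuantumFields.YangMills.Theorems.BrascampLiebVacuumSC

end
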